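import Mathlib
import HarnessLib
import Literature.NumberTheory.Sieve.BatemanHorn

/-!
# Additivity of the zero functional over the Euler species (stub `stub_eulerAdditivity`, E1)

Line `euler-species-factorisation` of crux stmt-Parity-11291
(`Summit.Parity.BatemanHorn.Theses.AlmostPrimeZeros.SystemZeroRepulsion`), stub E1.

For a family `f : Fin k → ℤ[X]`, a prime `p` and `n ∈ ℕ` let
`s_{f,p}(n) = Σ_i ([p ∣ f_i(n)] + [p² ∣ f_i(n)])` (capped local statistic) and
`E_p = Σ_{n < p²} X^{s_{f,p}(n)} ∈ ℂ[X]` (Euler-species factor; `E_p(1) = p² ≠ 0`).  For the zero functional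
`T(P) = Σ_ρ ‖1 − ρ‖⁻²` (sum over the roots of `P` in `ℂ`, with multiplicity) we prove
`T(∏_{p ≤ y, p prime} E_p) = Σ_{p ≤ y, p prime} T(E_p)`: the root multiset of a product of non-zero complex
polynomials is the sum of the root multisets (`Polynomial.roots_prod`).
-/

namespace Summit.Parity.BatemanHorn.Cruxes.SystemZeroRepulsion.EulerSpeciesFactorisation

open Polynomial

/-- Additivity of a root functional over a finite product of non-zero polynomials: the root
multiset of `∏ i ∈ s, E i` is the sum (bind) of the root multisets (`Polynomial.roots_prod`). -/
private theorem sum_map_roots_prod {ι M : Type*} [AddCommMonoid M] (s : Finset ι) (E : ι → ℂ[X])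
    (g : ℂ → M) (hE : ∀ i ∈ s, E i ≠ 0) :
    ((∏ i ∈ s, E i).roots.map g).sum = ∑ i ∈ s, ((E i).roots.map g).sum := by
  rw [Polynomial.roots_prod E s (Finset.prod_ne_zero_iff.mpr hE), Multiset.map_bind,
    Multiset.sum_bind]
  rfl

/-- A polynomial of the shape `∑ n ∈ range m, X ^ (e n)` evaluates to `m` at `1`, hence is non-zero
as soon as `m ≠ 0`. -/
private theorem sum_X_pow_ne_zero (m : ℕ) (e : ℕ → ℕ) (hm : m ≠ 0) :
    (∑ n ∈ Finset.range m, (Polynomial.X : Polynomial ℂ) ^ (e n)) ≠ 0 := by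
  intro h0
  have h1 := congrArg (Polynomial.eval (1 : ℂ)) h0
  simp only [Polynomial.eval_finsetSum, Polynomial.eval_pow, Polynomial.eval_X, one_pow,
    Finset.sum_const, Finset.card_range, nsmul_eq_mul, mul_one, Polynomial.eval_zero,
    Nat.cast_eq_zero] at h1
  exact hm h1

/-- **E1 (additivity of `T` over the Euler species).** For every family `f : Fin k → ℤ[X]` and every `y`,
`T(∏_{p ≤ y prime} E_p) = Σ_{p ≤ y prime} T(E_p)` where `E_p = Σ_{n<p²} X^{s_{f,p}(n)}` and
`T(P) = Σ_{ρ ∈ roots P} ‖1−ρ‖⁻²`: `Polynomial.roots_prod` (each `E_p ≠ 0` since `E_p(1) = p² ≠ 0`),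
`Multiset.map_bind`, `Multiset.sum_bind`. -/
theorem stub_eulerAdditivity :
    ∀ (k : ℕ) (f : Fin k → Polynomial ℤ) (y : ℕ),
      ((∏ p ∈ (Finset.range (y + 1)).filter Nat.Prime,
          ∑ n ∈ Finset.range (p ^ 2), (Polynomial.X : Polynomial ℂ) ^
            (∑ i, ((if ((p : ℤ) ∣ (f i).eval (n : ℤ)) then 1 else 0) +
              (if ((p : ℤ) ^ 2 ∣ (f i).eval (n : ℤ)) then 1 else 0)))).roots.map
        (fun ρ : ℂ => (‖(1 : ℂ) - ρ‖ ^ 2)⁻¹)).sum =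
      ∑ p ∈ (Finset.range (y + 1)).filter Nat.Prime,
        ((∑ n ∈ Finset.range (p ^ 2), (Polynomial.X : Polynomial ℂ) ^
            (∑ i, ((if ((p : ℤ) ∣ (f i).eval (n : ℤ)) then 1 else 0) +
              (if ((p : ℤ) ^ 2 ∣ (f i).eval (n : ℤ)) then 1 else 0)))).roots.map
          (fun ρ : ℂ => (‖(1 : ℂ) - ρ‖ ^ 2)⁻¹)).sum := by
  intro k f y
  refine sum_map_roots_prod _ _ _ ?_
  intro p hp
  have hp' : p ≠ 0 := (Finset.mem_filter.mp hp).2.ne_zero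
  exact sum_X_pow_ne_zero (p ^ 2) _ (pow_ne_zero 2 hp')

end Summit.Parity.BatemanHorn.Cruxes.SystemZeroRepulsion.EulerSpeciesFactorisation
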